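import Literature.NumberTheory.Sieve.PolymathThetaSumsProofs
import HarnessLib

/-!
# The sieve asymptotic for a general inner sequence (backbone of Theorem 3.6(ii))

Trunk AntSieve, tooling toward the named fact `Literature.NumberTheory.Sieve.weakDHL_three_two_of_GEH`
(D. H. J. Polymath, Res. Math. Sci. 1:12 (2014) = arXiv:1407.4897, Theorem 3.2(xii)).

§4.5 (p. 16): "The basic idea is to view the sum (lflg) as a variant of (theta-oo), with the role of the
function `θ` now being played by the product divisor sum `λ_{F_k} λ_{G_k}`, and to repeat the arguments
in Section 4.2."  This file repeats the arguments of §4.2 (the tree's proof of Theorem 3.5(i),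
`theta_divisorSumWeights_asymptotic_holds`) ONCE for an arbitrary inner sequence `w_x : ℕ → ℝ` in place
of `θ`, isolating exactly the two inputs the argument needs:

* (main term) `Σ_{x+h₀ ≤ m ≤ 2x+h₀} w_x(m) = (c_w + o(1)) x/log x`;
* (level of distribution, divisor-weighted) for every `K ≥ 0`, `A > 0`:
  `Σ_{q ≤ x^{ϑ'}} K^{ω(q)} max_{(a,q)=1} |Σ_{m ≡ a (q)} w_x(m) - (1/φ(q)) Σ_m w_x(m)| ≪ x/log^A x`
  (sums over `x+h₀ ≤ m ≤ 2x+h₀`; the mean is over ALL `m`, so that the terms with `(m, q) > 1` — the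
  sum `Σ₂` of p. 16 — are part of the discrepancy),

and concluding `Σ_{x≤n≤2x, n≡b(W)} w_x(n+h₀) ∏_{h≠h₀} λ_{F_h}(n+h) λ_{G_h}(n+h)
  = (c_w ∏_{h≠h₀} ∫₀¹ F_h' G_h' + o(1)) B^{-k} x/W` when `Σ_{h≠h₀} (S(F_h)+S(G_h)) < ϑ' < 1`
(`innerSum_divisorSumWeights_asymptotic`).  Ingredients as in §4.2: expansion of the divisor sums,
vanishing of inadmissible terms, the Chinese remainder theorem (`PolymathThetaCRT.lean`), the
`φ`-variant of Lemma 4.1 (`LcmEuler.tendsto_pow_mul_lcmSumW`), the multiplicity bound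
`sum_modulusOf_le`.  With `w = θ` and the level from `EH` this is Theorem 3.5(i) again; with
`w = λ_F λ_G 1_{p(·) > x^ε}` and the level from `GEH` it is the core of Theorem 3.6(ii).

## References

* [Polymath8b2014] D. H. J. Polymath, Res. Math. Sci. 1 (2014), Art. 12 = arXiv:1407.4897,
  §4.2 (pp. 13–14), §4.5 (pp. 16–17), Theorem 3.6(ii).
-/

noncomputable section

open Finset Filter Asymptotics MeasureTheory
open scoped BigOperators ArithmeticFunction.omega ArithmeticFunction.Moebius

namespace Literature.NumberTheory.Sieve

/-! ### Inner sums over an interval and a residue class -/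

/-- `Σ_{X₁ < m ≤ X₂, m ≡ r (q)} w(m)`. [cite: Polymath8b2014, §4.5, (sp3-def)] -/
def innerAP (w : ℕ → ℝ) (q r X₁ X₂ : ℕ) : ℝ :=
  ∑ m ∈ (Finset.Ioc X₁ X₂).filter (fun m => m ≡ r [MOD q]), w m

/-- `Σ_{X₁ < m ≤ X₂} w(m)`. [cite: Polymath8b2014, §4.5, (sp1-def)] -/
def innerTotal (w : ℕ → ℝ) (X₁ X₂ : ℕ) : ℝ :=
  ∑ m ∈ Finset.Ioc X₁ X₂, w m

/-- The maximal discrepancy over primitive classes, against the full mean: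
`max_{(a,q)=1} |Σ_{m ≡ a (q)} w(m) - (1/φ(q)) Σ_m w(m)|` (sums over `X₁ < m ≤ X₂`). [cite: Polymath8b2014, §4.5, (local)] -/
def innerErr (w : ℕ → ℝ) (q X₁ X₂ : ℕ) : ℝ :=
  ⨆ a : (ZMod q)ˣ, |innerAP w q (a : ZMod q).val X₁ X₂ - innerTotal w X₁ X₂ / Nat.totient q|

/-- `innerErr ≥ 0`. [folklore] -/
theorem innerErr_nonneg (w : ℕ → ℝ) (q X₁ X₂ : ℕ) : 0 ≤ innerErr w q X₁ X₂ :=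
  Real.iSup_nonneg fun _ => abs_nonneg _

/-- `innerAP` only depends on the residue `r` modulo `q`. [folklore] -/
theorem innerAP_congr {w : ℕ → ℝ} {q r r' X₁ X₂ : ℕ} (h : r ≡ r' [MOD q]) :
    innerAP w q r X₁ X₂ = innerAP w q r' X₁ X₂ := by
  unfold innerAP
  refine Finset.sum_congr (Finset.filter_congr fun m _ => ⟨fun hm => hm.trans h, fun hm => hm.trans h.symm⟩)
    fun _ _ => rfl

/-- A primitive class is bounded by the maximal discrepancy. [folklore] -/
theorem abs_innerAP_sub_le_innerErr (w : ℕ → ℝ) {q r : ℕ} (hr : r.Coprime q) (X₁ X₂ : ℕ) :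
    |innerAP w q r X₁ X₂ - innerTotal w X₁ X₂ / Nat.totient q| ≤ innerErr w q X₁ X₂ := by
  set u : (ZMod q)ˣ := ZMod.unitOfCoprime r hr with hu
  have hval : (u : ZMod q).val ≡ r [MOD q] := by
    rw [hu, ZMod.coe_unitOfCoprime, ZMod.val_natCast]
    exact Nat.mod_modEq r q
  have hbdd : BddAbove (Set.range fun a : (ZMod q)ˣ =>
      |innerAP w q (a : ZMod q).val X₁ X₂ - innerTotal w X₁ X₂ / Nat.totient q|) :=
    (Set.finite_range _).bddAbove
  calc |innerAP w q r X₁ X₂ - innerTotal w X₁ X₂ / Nat.totient q|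
      = |innerAP w q (u : ZMod q).val X₁ X₂ - innerTotal w X₁ X₂ / Nat.totient q| := by
        rw [innerAP_congr hval]
    _ ≤ innerErr w q X₁ X₂ := le_ciSup hbdd u

section CRT

variable {ι : Type*} [Fintype ι]

open LcmEuler in
/-- **The count as an inner sum over one progression** (the analogue of `sum_theta_eq_thetaAP` for a
general inner sequence): with `a` from the Chinese remainder theorem and `N₁ + h₀ ≥ 1`,
`Σ_{N₁ ≤ n ≤ N₂, n ≡ b (W), [d_i,d'_i] ∣ n+h_i ∀ i} w(n + h₀) = Σ_{X₁ < m ≤ X₂, m ≡ r (q)} w(m)` with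
`X₁ = N₁ + h₀ - 1`, `X₂ = N₂ + h₀`, `r = (a + h₀) mod q`. [cite: Polymath8b2014, §4.5, (ddd)] -/
theorem sum_shift_eq_innerAP (w : ℕ → ℝ) {W : ℕ} (hW : 0 < W) {b : ℤ} {h : ι → ℤ} {h₀ : ℤ}
    {t : (ι → ℕ) × (ι → ℕ)} (hpos : ∀ i, 0 < t.1 i ∧ 0 < t.2 i) {a : ℤ}
    (ha : ∀ n : ℤ, (n ≡ b [ZMOD W] ∧ ∀ i, ((Nat.lcm (t.1 i) (t.2 i) : ℕ) : ℤ) ∣ n + h i) ↔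
      n ≡ a [ZMOD ((modulusOf W t : ℕ) : ℤ)])
    {N₁ N₂ : ℕ} (hN₁ : 1 ≤ (N₁ : ℤ) + h₀) :
    ∑ n ∈ ((Finset.Icc N₁ N₂).filter fun n : ℕ => (n : ℤ) ≡ b [ZMOD W]).filter
        (fun n : ℕ => ∀ i, ((Nat.lcm (t.1 i) (t.2 i) : ℕ) : ℤ) ∣ (n : ℤ) + h i),
      w (((n : ℤ) + h₀).toNat) =
    innerAP w (modulusOf W t) (((a + h₀) % (modulusOf W t : ℤ)).toNat)
      (((N₁ : ℤ) + h₀ - 1).toNat) (((N₂ : ℤ) + h₀).toNat) := by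
  set q : ℕ := modulusOf W t with hqdef
  have hqpos : 0 < q := by
    rw [hqdef, modulusOf]
    exact Nat.mul_pos hW (Finset.prod_pos fun i _ => Nat.lcm_pos (hpos i).1 (hpos i).2)
  have hqz : (0 : ℤ) < (q : ℤ) := by exact_mod_cast hqpos
  set r : ℕ := ((a + h₀) % (q : ℤ)).toNat with hrdef
  have hr0 : (0 : ℤ) ≤ (a + h₀) % (q : ℤ) := Int.emod_nonneg _ hqz.ne'
  have hrz : (r : ℤ) = (a + h₀) % (q : ℤ) := Int.toNat_of_nonneg hr0
  have hrmod : (r : ℤ) ≡ a + h₀ [ZMOD q] := by rw [hrz]; exact Int.mod_modEq _ _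
  -- rewrite the double filter through the single congruence
  have hfilter : ((Finset.Icc N₁ N₂).filter fun n : ℕ => (n : ℤ) ≡ b [ZMOD W]).filter
        (fun n : ℕ => ∀ i, ((Nat.lcm (t.1 i) (t.2 i) : ℕ) : ℤ) ∣ (n : ℤ) + h i) =
      (Finset.Icc N₁ N₂).filter fun n : ℕ => (n : ℤ) ≡ a [ZMOD q] := by
    rw [Finset.filter_filter]
    exact Finset.filter_congr fun n _ => ha n
  rw [hfilter, innerAP]
  -- the bijection `n ↦ n + h₀`
  refine Finset.sum_nbij' (fun n : ℕ => ((n : ℤ) + h₀).toNat) (fun m : ℕ => ((m : ℤ) - h₀).toNat)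
    ?_ ?_ ?_ ?_ ?_
  · intro n hn
    rw [Finset.mem_filter, Finset.mem_Icc] at hn
    obtain ⟨⟨hn1, hn2⟩, hna⟩ := hn
    have hn0 : 0 ≤ (n : ℤ) + h₀ := by omega
    rw [Finset.mem_filter, Finset.mem_Ioc]
    refine ⟨⟨?_, ?_⟩, ?_⟩
    · zify; rw [Int.toNat_of_nonneg hn0]; omega
    · zify; rw [Int.toNat_of_nonneg hn0]; omega
    · rw [← Int.natCast_modEq_iff, Int.toNat_of_nonneg hn0]
      exact (hna.add_right h₀).trans hrmod.symm
  · intro m hm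
    rw [Finset.mem_filter, Finset.mem_Ioc] at hm
    obtain ⟨⟨hm1, hm2⟩, hmr⟩ := hm
    have hm0 : 0 ≤ (m : ℤ) - h₀ := by omega
    rw [Finset.mem_filter, Finset.mem_Icc]
    refine ⟨⟨?_, ?_⟩, ?_⟩
    · zify; rw [Int.toNat_of_nonneg hm0]; omega
    · zify; rw [Int.toNat_of_nonneg hm0]; omega
    · rw [Int.toNat_of_nonneg hm0]
      have h1 : (m : ℤ) ≡ a + h₀ [ZMOD q] := (Int.natCast_modEq_iff.2 hmr).trans hrmod
      have := h1.sub_right h₀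
      simpa using this
  · intro n hn
    rw [Finset.mem_filter, Finset.mem_Icc] at hn
    have hn0 : 0 ≤ (n : ℤ) + h₀ := by omega
    simp only [Int.toNat_of_nonneg hn0, add_sub_cancel_right, Int.toNat_natCast]
  · intro m hm
    rw [Finset.mem_filter, Finset.mem_Ioc] at hm
    have hm0 : 0 ≤ (m : ℤ) - h₀ := by omega
    simp only [Int.toNat_of_nonneg hm0, sub_add_cancel, Int.toNat_natCast]
  · intro n hn
    rfl


end CRT

/-! ### The asymptotic for a general inner sequence -/

set_option maxHeartbeats 1600000 in
open LcmEuler in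
/-- **The argument of §4.2 for a general inner sequence `w_x`** (Polymath 8b §4.5, p. 16: "repeat the
arguments in Section 4.2" with `θ` replaced by the inner sequence).  Let `H` be admissible,
`h₀ ∈ H`, `b (W)` with `b + h` coprime to `W`, and for `h ≠ h₀` smooth cutoffs with
`Σ_{h≠h₀} (S(F_h) + S(G_h)) < ϑ' < 1`.  Let `w_x : ℕ → ℝ` satisfy, with `X₁ = ⌈x⌉+h₀-1`, `X₂ = ⌊2x⌋+h₀`:
(i) `Σ_{X₁<m≤X₂} w_x(m) = c_w x/log x + o(x/log x)`; (ii) for all `K ≥ 0`, `A > 0`,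
`Σ_{q ≤ x^{ϑ'}} K^{ω(q)} max_{(a,q)=1} |Σ_{X₁<m≤X₂, m≡a(q)} w_x(m) - (1/φ(q)) Σ_{X₁<m≤X₂} w_x(m)| = O(x/log^A x)`.
Then `Σ_{x≤n≤2x, n≡b(W)} w_x(n+h₀) ∏_{h≠h₀} λ_{F_h}(n+h)λ_{G_h}(n+h) = (c_w ∏_{h≠h₀}∫₀¹F_h'G_h' + o(1)) x/(B^{#H} W)`
(note `B^{k-1} x/(φ(W) log x) = B^{-k} x/W`).  Proof: the tree's proof of Theorem 3.5(i) verbatim with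
`θ ↦ w_x`, the prime number theorem replaced by (i) and `EH` by (ii). [cite: Polymath8b2014, §4.5, pp. 16–17] -/
theorem innerSum_divisorSumWeights_asymptotic (H : Finset ℤ) (hk1H : 1 ≤ #H)
    (b : ℝ → ℤ) (hb : ∀ x, ∀ h ∈ H, Int.gcd (b x + h) (polymathW x) = 1)
    (h₀ : ℤ) (hh₀ : h₀ ∈ H) {θ : ℝ} (hθ0 : 0 < θ) (hθ1 : θ < 1)
    (F G : ℤ → ℝ → ℝ) (sF sG : ℤ → ℝ)
    (hF : ∀ h ∈ H.erase h₀, IsSieveCutoff (F h) (sF h))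
    (hG : ∀ h ∈ H.erase h₀, IsSieveCutoff (G h) (sG h))
    (hsum : ∑ h ∈ H.erase h₀, (sF h + sG h) < θ)
    (w : ℝ → ℕ → ℝ) (cw : ℝ)
    (hmain : (fun x : ℝ => innerTotal (w x) (thetaX1 h₀ x) (thetaX2 h₀ x) - cw * (x / Real.log x))
      =o[atTop] fun x : ℝ => x / Real.log x)
    (hlev : ∀ K : ℝ, 0 ≤ K → ∀ A : ℝ, 0 < A →
      (fun x : ℝ => ∑ q ∈ Finset.Icc 1 ⌊x ^ θ⌋₊,
        K ^ ω q * innerErr (w x) q (thetaX1 h₀ x) (thetaX2 h₀ x)) =O[atTop]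
        fun x : ℝ => x / Real.log x ^ A) :
    (fun x : ℝ => ∑ n ∈ polymathRange x (b x),
          w x (((n : ℤ) + h₀).toNat) * ∏ h ∈ H.erase h₀, (divisorSumWeight (F h) x ((n : ℤ) + h).toNat *
            divisorSumWeight (G h) x ((n : ℤ) + h).toNat)
        - (cw * ∏ h ∈ H.erase h₀, ∫ t in (0 : ℝ)..1, deriv (F h) t * deriv (G h) t) *
          (x / (polymathB x ^ #H * polymathW x)))
      =o[atTop] fun x : ℝ => x / (polymathB x ^ #H * polymathW x) := by
  classical
  -- the index set `H' = H ∖ {h₀}` and `k = #H' = #H - 1`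
  set H' : Finset ℤ := H.erase h₀ with hH'def
  set k : ℕ := #H' with hkdef
  have hkH : #H = k + 1 := by
    rw [hkdef, hH'def, Finset.card_erase_of_mem hh₀]; omega
  simp only [hkH]
  set σ : ℝ := ∑ h ∈ H', (sF h + sG h) with hσdef
  have hσθ : σ < θ := hsum
  have hσ0 : 0 ≤ σ := Finset.sum_nonneg fun i hi => add_nonneg (hF i hi).nonneg (hG i hi).nonneg
  have hsFle : ∀ h ∈ H', sF h ≤ σ - sG h := fun h hh => by
    have h1 : sF h + sG h ≤ σ := Finset.single_le_sum (f := fun h => sF h + sG h)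
      (fun i hi => add_nonneg (hF i hi).nonneg (hG i hi).nonneg) hh
    linarith
  have hsF1 : ∀ h ∈ H', sF h < 1 := fun h hh => by
    linarith [hsFle h hh, (hG h hh).nonneg]
  have hsG1 : ∀ h ∈ H', sG h < 1 := fun h hh => by
    linarith [hsFle h hh, (hF h hh).nonneg]
  clear_value σ
  have hmemH : ∀ i : ↥H', (i : ℤ) ∈ H ∧ (i : ℤ) ≠ h₀ := fun i => by
    have := Finset.mem_erase.1 (show (i : ℤ) ∈ H.erase h₀ from i.2); exact ⟨this.2, this.1⟩
  -- Lemma 4.1 with the weight `1/φ`, `T = 1`, indexed by `↥H'`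
  have h41 := LcmEuler.tendsto_pow_mul_lcmSumW (ι := ↥H') (F := fun i => F i) (G := fun i => G i)
    (sF := fun i => sF i) (sG := fun i => sG i)
    (fun i => hF i i.2) (fun i => hG i i.2) isLcmWeight_totient_inv (T := 1)
    (fun i => (hsF1 i i.2).le) (fun i => (hsG1 i i.2).le)
  rw [Fintype.card_coe] at h41
  -- the constant `c`
  set c : ℝ := ∏ h ∈ H', ∫ t in (0 : ℝ)..1, deriv (F h) t * deriv (G h) t with hcdef
  have hc : (∏ i : ↥H', ((∫ t in Set.Ioi (0 : ℝ), deriv (F i) t * deriv (G i) t : ℝ) : ℂ)) = (c : ℂ) := by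
    rw [hcdef, ← Finset.prod_coe_sort H', Complex.ofReal_prod]
    exact Finset.prod_congr rfl fun i _ => by rw [(hF i i.2).setIntegral_Ioi_deriv_mul (hsF1 i i.2).le]
  rw [hc] at h41
  clear_value c
  -- the real `φ`-weighted sum and its limit
  set Sφ : ℝ → ℝ := fun x => ∑ d ∈ lcmBox (↥H') ⌊x⌋₊, ∑ d' ∈ lcmBox (↥H') ⌊x⌋₊,
    if LcmCoprime (polymathW x) d d' then
      (∏ i : ↥H', ((μ (d i) : ℝ) * F i (Real.log (d i) / Real.log x)) *
        ((μ (d' i) : ℝ) * G i (Real.log (d' i) / Real.log x))) *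
      ∏ i : ↥H', ((Nat.totient (Nat.lcm (d i) (d' i)) : ℕ) : ℝ)⁻¹ else 0 with hSφdef
  have h41r : Tendsto (fun x : ℝ => polymathB x ^ k * Sφ x) atTop (nhds c) := by
    have h2 := (Complex.continuous_re.tendsto _).comp h41
    rw [Complex.ofReal_re] at h2
    refine h2.congr fun x => ?_
    rw [Function.comp_apply, Real.rpow_one, lcmSumW_totient_eq_ofReal, ← Complex.ofReal_pow,
      ← Complex.ofReal_mul, Complex.ofReal_re]
  clear_value Sφ
  -- the level of distribution, divisor-weighted (hypothesis (ii))
  set ε₁ : ℝ := θ - σ with hε₁def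
  have hε₁ : 0 < ε₁ := by rw [hε₁def]; linarith
  set K : ℝ := ((3 * k + 1 : ℕ) : ℝ) with hKdef
  have hK0 : 0 ≤ K := by rw [hKdef]; positivity
  have hbig := hlev K hK0 ((k : ℝ) + 4) (by positivity)
  obtain ⟨Cb, hCbpos, hCb⟩ := hbig.exists_pos
  rw [IsBigOWith] at hCb
  clear_value ε₁ K
  -- a uniform bound `M` for the cutoffs on `[0, 1]`
  obtain ⟨M, hM0, hMF, hMG⟩ : ∃ M : ℝ, 0 ≤ M ∧ (∀ h ∈ H', ∀ t ∈ Set.Icc (0 : ℝ) 1, |F h t| ≤ M) ∧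
      (∀ h ∈ H', ∀ t ∈ Set.Icc (0 : ℝ) 1, |G h t| ≤ M) := by
    have hbd : ∀ f : ℝ → ℝ, Continuous f → ∃ C, ∀ t ∈ Set.Icc (0 : ℝ) 1, |f t| ≤ C := fun f hf => by
      obtain ⟨C, hC⟩ := isCompact_Icc.exists_bound_of_continuousOn hf.continuousOn
      exact ⟨C, fun t ht => by simpa [Real.norm_eq_abs] using hC t ht⟩
    choose CF hCF using fun h : ↥H' => hbd (F h) (hF h h.2).contDiff.continuous
    choose CG hCG using fun h : ↥H' => hbd (G h) (hG h h.2).contDiff.continuous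
    refine ⟨∑ i : ↥H', (|CF i| + |CG i|), Finset.sum_nonneg fun i _ => by positivity, ?_, ?_⟩
    · intro h hh t ht
      have h1 := hCF ⟨h, hh⟩ t ht
      have h2 : |CF ⟨h, hh⟩| + |CG ⟨h, hh⟩| ≤ ∑ i : ↥H', (|CF i| + |CG i|) :=
        Finset.single_le_sum (f := fun i : ↥H' => |CF i| + |CG i|) (fun i _ => by positivity)
          (Finset.mem_univ _)
      linarith [le_abs_self (CF ⟨h, hh⟩), abs_nonneg (CG ⟨h, hh⟩)]
    · intro h hh t ht
      have h1 := hCG ⟨h, hh⟩ t ht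
      have h2 : |CF ⟨h, hh⟩| + |CG ⟨h, hh⟩| ≤ ∑ i : ↥H', (|CF i| + |CG i|) :=
        Finset.single_le_sum (f := fun i : ↥H' => |CF i| + |CG i|) (fun i _ => by positivity)
          (Finset.mem_univ _)
      linarith [le_abs_self (CG ⟨h, hh⟩), abs_nonneg (CF ⟨h, hh⟩)]
  -- size of the shifts
  set P₀ : ℕ := ∑ h ∈ H, h.natAbs with hP₀def
  have hP₀ : ∀ h ∈ H, h.natAbs ≤ P₀ := fun h hh =>
    Finset.single_le_sum (f := fun h : ℤ => h.natAbs) (fun _ _ => Nat.zero_le _) hh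
  have hP₀h₀ : h₀.natAbs ≤ P₀ := hP₀ h₀ hh₀
  -- the `ε`-argument
  refine Asymptotics.isLittleO_iff.2 fun ε hε => ?_
  set εP : ℝ := min 1 (ε / (3 * (|c| + 1))) with hεPdef
  have hεP : 0 < εP := by positivity
  have hεP1 : εP ≤ 1 := min_le_left _ _
  have hεPc : |c| * εP ≤ ε / 3 := by
    have h1 : εP ≤ ε / (3 * (|c| + 1)) := min_le_right _ _
    have h2 : |c| * (ε / (3 * (|c| + 1))) ≤ ε / 3 := by
      rw [mul_div_assoc', div_le_div_iff₀ (by positivity) (by positivity)]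
      nlinarith [abs_nonneg c]
    exact le_trans (mul_le_mul_of_nonneg_left h1 (abs_nonneg c)) h2
  set ε41 : ℝ := ε / (9 * (|cw| + 1)) with hε41def
  have hε41 : 0 < ε41 := by positivity
  have hε41c : (|cw| + 1) * ε41 = ε / 9 := by rw [hε41def]; field_simp
  set Cerr : ℝ := 3 * (M ^ k * M ^ k) * Cb with hCerrdef
  filter_upwards [eventually_gt_atTop (3 : ℝ),
    Metric.tendsto_nhds.1 h41r ε41 hε41,
    hmain.def hεP,
    hCb,
    eventually_ge_atTop ((P₀ : ℝ) + 2),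
    (tendsto_nat_floor_atTop.comp tendsto_polymathw_atTop).eventually_ge_atTop (2 * P₀),
    eventually_polymathW_le_log_sq,
    Real.tendsto_log_atTop.eventually_ge_atTop (1 : ℝ),
    (isLittleO_log_rpow_rpow_atTop 2 hε₁).def zero_lt_one,
    Real.tendsto_log_atTop.eventually_ge_atTop (Cerr / ε)]
    with x hx3 hx41 hxmain hxCb hxP hxw hxW hxlog hxlogε hxCerr
  clear h41 h41r hbig hCb
  -- notation and positivity at this `x`
  have hx1 : 1 < x := by linarith
  have hx0 : 0 ≤ x := by linarith
  have hxpos : 0 < x := by linarith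
  -- make the level-of-distribution bound opaque
  obtain ⟨Lsum, hLsum_def, hLsum⟩ : ∃ L : ℝ,
      L = ∑ q ∈ Finset.Icc 1 ⌊x ^ θ⌋₊,
        K ^ ω q * innerErr (w x) q (thetaX1 h₀ x) (thetaX2 h₀ x) ∧
      ‖L‖ ≤ Cb * ‖x / Real.log x ^ ((k : ℝ) + 4)‖ :=
    ⟨_, rfl, hxCb⟩
  clear hxCb
  have hlog : 0 < Real.log x := Real.log_pos hx1
  have hWpos : 0 < polymathW x := polymathW_pos x
  have hWr : (0 : ℝ) < polymathW x := Nat.cast_pos.2 hWpos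
  have hφpos : 0 < Nat.totient (polymathW x) := totient_polymathW_pos x
  have hφr : (0 : ℝ) < Nat.totient (polymathW x) := Nat.cast_pos.2 hφpos
  have hB : 0 < polymathB x := polymathB_pos hx1
  have hBk : 0 < polymathB x ^ k := pow_pos hB k
  set D : ℕ := ⌊x⌋₊ with hDdef
  set R : Finset ℕ := polymathRange x (b x) with hRdef
  have hlogne : Real.log x ≠ 0 := (Real.log_pos hx1).ne'
  have hBW : polymathB x ^ (k + 1) * polymathW x =
      polymathB x ^ k * Nat.totient (polymathW x) * Real.log x := by
    rw [pow_succ, polymathB]; field_simp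
  simp only [hBW]
  set Mx : ℝ := x / (polymathB x ^ k * Nat.totient (polymathW x) * Real.log x) with hMx
  have hMx0 : 0 < Mx := by positivity
  have hxh₀ : (h₀.natAbs : ℝ) + 2 ≤ x := by
    have : (h₀.natAbs : ℝ) ≤ P₀ := by exact_mod_cast hP₀h₀
    linarith
  have habsR : ((h₀.natAbs : ℕ) : ℝ) = |(h₀ : ℝ)| := by rw [Nat.cast_natAbs, Int.cast_abs]
  have hh₀1 : -(h₀ : ℝ) ≤ h₀.natAbs := by rw [habsR]; exact neg_le_abs _
  have hh₀2 : (h₀ : ℝ) ≤ h₀.natAbs := by rw [habsR]; exact le_abs_self _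
  obtain ⟨hX₁1, hX₁₂, hX₁lo, hX₁hi, hX₂lo, hX₂hi, hX₁z, hX₂z⟩ := thetaX_bounds h₀ hxh₀
  set X₁ : ℕ := thetaX1 h₀ x with hX₁def
  set X₂ : ℕ := thetaX2 h₀ x with hX₂def
  clear_value X₁ X₂
  set xL : ℝ := x / Real.log x with hxLdef
  have hxL0 : 0 < xL := by positivity
  set Θ : ℝ := innerTotal (w x) X₁ X₂ with hΘdef
  have hΘx : |Θ - cw * xL| ≤ εP * xL := by
    have h := hxmain
    rw [Real.norm_eq_abs, Real.norm_eq_abs, abs_of_pos hxL0] at h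
    simpa only [hΘdef, hX₁def, hX₂def, hxLdef] using h
  clear hxmain
  have hΘabs : |Θ| ≤ (|cw| + 1) * xL := by
    have h1 : |Θ| ≤ |cw * xL| + |Θ - cw * xL| := by
      have := abs_add_le (cw * xL) (Θ - cw * xL); rwa [add_sub_cancel] at this
    rw [abs_mul, abs_of_pos hxL0] at h1
    have h2 : εP * xL ≤ 1 * xL := mul_le_mul_of_nonneg_right hεP1 hxL0.le
    linarith
  clear_value Θ
  have hvan : ∀ (f : ℝ → ℝ) (s : ℝ), IsSieveCutoff f s → s < 1 →
      ∀ e : ℕ, D < e → f (Real.log e / Real.log x) = 0 := by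
    intro f s hf hs e he
    apply hf.eq_zero
    have he' : x < e := by
      have : (D : ℝ) + 1 ≤ e := by exact_mod_cast he
      linarith [Nat.lt_floor_add_one x]
    rw [lt_div_iff₀ hlog]
    calc s * Real.log x < 1 * Real.log x := mul_lt_mul_of_pos_right hs hlog
      _ = Real.log x := one_mul _
      _ < Real.log e := Real.log_lt_log hxpos he'
  -- members of the range are large
  have hRmem : ∀ n ∈ R, x ≤ n ∧ (n : ℤ) ≡ b x [ZMOD (polymathW x)] := fun n hn =>
    ⟨(le_of_mem_polymathRange hx0 hn).1, (Finset.mem_filter.1 hn).2⟩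
  have hnpos : ∀ n ∈ R, ∀ i : ↥H', 0 < (n : ℤ) + (i : ℤ) := by
    intro n hn i
    have h2 : (P₀ : ℝ) + 2 ≤ n := hxP.trans (hRmem n hn).1
    have h4 : ((P₀ : ℕ) : ℤ) + 2 ≤ n := by exact_mod_cast h2
    have h5 : (i : ℤ).natAbs ≤ P₀ := hP₀ i (hmemH i).1
    omega
  -- the coefficients and the θ-weighted counts
  set a : ↥H' → ℕ → ℝ := fun i e => (μ e : ℝ) * F i (Real.log e / Real.log x) with hadef
  set a' : ↥H' → ℕ → ℝ := fun i e => (μ e : ℝ) * G i (Real.log e / Real.log x) with ha'def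
  set cc : (↥H' → ℕ) → (↥H' → ℕ) → ℝ := fun d d' => ∏ i, (a i (d i) * a' i (d' i)) with hccdef
  set Nθ : (↥H' → ℕ) → (↥H' → ℕ) → ℝ := fun d d' =>
    ∑ n ∈ R.filter (fun n : ℕ => ∀ i : ↥H', ((Nat.lcm (d i) (d' i) : ℕ) : ℤ) ∣ (n : ℤ) + (i : ℤ)),
      w x (((n : ℤ) + h₀).toNat) with hNθdef
  have hstep1 : ∀ n ∈ R,
      w x (((n : ℤ) + h₀).toNat) * ∏ h ∈ H', (divisorSumWeight (F h) x ((n : ℤ) + h).toNat *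
        divisorSumWeight (G h) x ((n : ℤ) + h).toNat) =
      ∑ d ∈ lcmBox (↥H') D, ∑ d' ∈ lcmBox (↥H') D,
        if ∀ i : ↥H', ((Nat.lcm (d i) (d' i) : ℕ) : ℤ) ∣ (n : ℤ) + (i : ℤ) then
          w x (((n : ℤ) + h₀).toNat) * cc d d' else 0 := by
    intro n hn
    set m : ↥H' → ℕ := fun i => ((n : ℤ) + (i : ℤ)).toNat with hmdef
    have hmcast : ∀ i : ↥H', ((m i : ℕ) : ℤ) = (n : ℤ) + (i : ℤ) := fun i =>
      Int.toNat_of_nonneg (hnpos n hn i).le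
    have hm0 : ∀ i : ↥H', m i ≠ 0 := fun i h0 => by
      have := hmcast i; rw [h0] at this; have := hnpos n hn i; omega
    rw [← Finset.prod_coe_sort H']
    have h1 : ∀ i : ↥H', divisorSumWeight (F i) x ((n : ℤ) + (i : ℤ)).toNat *
        divisorSumWeight (G i) x ((n : ℤ) + (i : ℤ)).toNat =
        (∑ e ∈ Finset.Icc 1 D, if e ∣ m i then a i e else 0) *
          ∑ e ∈ Finset.Icc 1 D, if e ∣ m i then a' i e else 0 := by
      intro i
      rw [divisorSumWeight_eq_sum_Icc (F i) x (hm0 i) (hvan _ _ (hF i i.2) (hsF1 i i.2)),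
        divisorSumWeight_eq_sum_Icc (G i) x (hm0 i) (hvan _ _ (hG i i.2) (hsG1 i i.2))]
    simp_rw [h1]
    rw [prod_sum_ite_dvd_mul_sum_ite_dvd, Finset.mul_sum]
    refine Finset.sum_congr rfl fun d _ => ?_
    rw [Finset.mul_sum]
    refine Finset.sum_congr rfl fun d' _ => ?_
    have hiff : (∀ i : ↥H', Nat.lcm (d i) (d' i) ∣ m i) ↔
        ∀ i : ↥H', ((Nat.lcm (d i) (d' i) : ℕ) : ℤ) ∣ (n : ℤ) + (i : ℤ) :=
      forall_congr' fun i => by rw [← hmcast i, Int.natCast_dvd_natCast]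
    simp only [hiff, hccdef]
    split_ifs <;> simp
  -- Step 2: interchange of summations
  have hstep2 : ∑ n ∈ R, w x (((n : ℤ) + h₀).toNat) *
        ∏ h ∈ H', (divisorSumWeight (F h) x ((n : ℤ) + h).toNat *
          divisorSumWeight (G h) x ((n : ℤ) + h).toNat) =
      ∑ d ∈ lcmBox (↥H') D, ∑ d' ∈ lcmBox (↥H') D, cc d d' * Nθ d d' := by
    rw [Finset.sum_congr rfl hstep1, Finset.sum_comm]
    refine Finset.sum_congr rfl fun d _ => ?_
    rw [Finset.sum_comm]
    refine Finset.sum_congr rfl fun d' _ => ?_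
    simp only [hNθdef]
    rw [← Finset.sum_filter, Finset.mul_sum]
    exact Finset.sum_congr rfl fun n _ => mul_comm _ _
  clear_value a a' cc Nθ
  -- Step 3: arithmetic of the shifts and admissibility
  have hb' : ∀ i : ↥H', Int.gcd (b x + (i : ℤ)) (polymathW x) = 1 := fun i => hb x i (hmemH i).1
  have hbh₀ : Int.gcd (b x + h₀) (polymathW x) = 1 := hb x h₀ hh₀
  have hxw' : 2 * P₀ ≤ ⌊polymathw x⌋₊ := hxw
  have hprime : ∀ p : ℕ, p.Prime → ∀ i j : ↥H', i ≠ j → (p : ℤ) ∣ (i : ℤ) - (j : ℤ) → p ∣ (polymathW x) := by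
    intro p hp i j hij hdvd
    have hne : (i : ℤ) - (j : ℤ) ≠ 0 := sub_ne_zero.2 fun h => hij (Subtype.ext h)
    have h1 : p ∣ ((i : ℤ) - (j : ℤ)).natAbs := Int.natCast_dvd.1 hdvd
    have h2 : p ≤ ((i : ℤ) - (j : ℤ)).natAbs := Nat.le_of_dvd (Int.natAbs_pos.2 hne) h1
    have h3 : ((i : ℤ) - (j : ℤ)).natAbs ≤ (i : ℤ).natAbs + (j : ℤ).natAbs := Int.natAbs_sub_le _ _
    have h4 : p ≤ ⌊polymathw x⌋₊ := by
      have := hP₀ i (hmemH i).1; have := hP₀ j (hmemH j).1; omega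
    exact (hp.dvd_primorial_iff.2 h4 : p ∣ primorial ⌊polymathw x⌋₊)
  -- no prime of an admissible `[d_i,d'_i]` divides `h₀ - h_i`
  have hshift : ∀ d d' : ↥H' → ℕ, LcmCoprime (polymathW x) d d' → ∀ i : ↥H', ∀ p : ℕ, p.Prime →
      p ∣ Nat.lcm (d i) (d' i) → ¬ (p : ℤ) ∣ h₀ - (i : ℤ) := by
    intro d d' hadm i p hp hpi hdvd
    have hpW : ¬ p ∣ (polymathW x) := fun h => by
      have := Nat.Coprime.coprime_dvd_left hpi (hadm.2 i)
      exact hp.one_lt.ne' (Nat.Coprime.eq_one_of_dvd this h)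
    have hplt : ⌊polymathw x⌋₊ + 1 ≤ p := floor_polymathw_lt_of_not_dvd hp hpW
    have hne : h₀ - (i : ℤ) ≠ 0 := sub_ne_zero.2 (hmemH i).2.symm
    have h1 : p ∣ (h₀ - (i : ℤ)).natAbs := Int.natCast_dvd.1 hdvd
    have h2 : p ≤ (h₀ - (i : ℤ)).natAbs := Nat.le_of_dvd (Int.natAbs_pos.2 hne) h1
    have h3 : (h₀ - (i : ℤ)).natAbs ≤ h₀.natAbs + (i : ℤ).natAbs := Int.natAbs_sub_le _ _
    have := hP₀ i (hmemH i).1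
    omega
  have hNzero : ∀ d d' : ↥H' → ℕ, ¬ LcmCoprime (polymathW x) d d' → Nθ d d' = 0 := by
    intro d d' hnot
    rw [hNθdef]
    refine Finset.sum_eq_zero fun n hn => ?_
    exfalso
    obtain ⟨hnR, hdvd⟩ := Finset.mem_filter.1 hn
    exact not_forall_lcm_dvd_of_not_lcmCoprime hnot (fun i : ↥H' => (i : ℤ)) (b x) hb' hprime
      (hRmem n hnR).2 hdvd
  -- Step 4: the admissible counts through one progression
  -- Step 4: the admissible counts through one progression
  have hNadm : ∀ d ∈ lcmBox (↥H') D, ∀ d' ∈ lcmBox (↥H') D, LcmCoprime (polymathW x) d d' →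
      |Nθ d d' - Θ / Nat.totient (modulusOf (polymathW x) (d, d'))| ≤
        innerErr (w x) (modulusOf (polymathW x) (d, d')) X₁ X₂ := by
    intro d hd d' hd' hadm
    have hpos : ∀ i : ↥H', 0 < d i ∧ 0 < d' i := fun i => ⟨pos_of_mem_lcmBox hd i, pos_of_mem_lcmBox hd' i⟩
    have hqpos : 0 < modulusOf (polymathW x) (d, d') :=
      Nat.mul_pos hWpos (Finset.prod_pos fun i _ => Nat.lcm_pos (hpos i).1 (hpos i).2)
    obtain ⟨a₀, ha₀⟩ := exists_crt_modulusOf (W := polymathW x) (b x) (fun i : ↥H' => (i : ℤ)) (t := (d, d')) hadm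
    have hN₁ : 1 ≤ ((⌈x⌉₊ : ℕ) : ℤ) + h₀ := by
      have := hX₁z; have := hX₁1; omega
    have hsum := sum_shift_eq_innerAP (w x) (ι := ↥H') hWpos (b := b x) (h := fun i : ↥H' => (i : ℤ))
      (h₀ := h₀) (t := (d, d')) hpos ha₀ (N₁ := ⌈x⌉₊) (N₂ := ⌊2 * x⌋₊) hN₁
    have hcop := coprime_residue_modulusOf (ι := ↥H') (t := (d, d')) hqpos ha₀ hbh₀ (hshift d d' hadm)
    have hNθeq : Nθ d d' = innerAP (w x) (modulusOf (polymathW x) (d, d'))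
        (((a₀ + h₀) % (modulusOf (polymathW x) (d, d') : ℤ)).toNat) X₁ X₂ := by
      simp only [hNθdef, hRdef, polymathRange, hX₁def, hX₂def, thetaX1, thetaX2]
      exact hsum
    rw [hNθeq, hΘdef]
    exact abs_innerAP_sub_le_innerErr (w x) hcop X₁ X₂
  -- Step 5: the coefficients: size and support
  have habs_a : ∀ i : ↥H', ∀ e : ℕ, 1 ≤ e → |a i e| ≤ M ∧ |a' i e| ≤ M := by
    intro i e he
    have hlog0 : 0 ≤ Real.log e / Real.log x := div_nonneg (Real.log_natCast_nonneg e) hlog.le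
    have hμ : |(μ e : ℝ)| ≤ 1 := by exact_mod_cast ArithmeticFunction.abs_moebius_le_one
    constructor
    · rw [hadef]; simp only; rw [abs_mul]
      rcases le_or_gt (Real.log e / Real.log x) 1 with hle | hgt
      · exact le_trans (mul_le_mul hμ (hMF i i.2 _ ⟨hlog0, hle⟩) (abs_nonneg _) zero_le_one) (by rw [one_mul])
      · rw [(hF i i.2).eq_zero _ (lt_of_lt_of_le (hsF1 i i.2) hgt.le), abs_zero, mul_zero]; exact hM0
    · rw [ha'def]; simp only; rw [abs_mul]
      rcases le_or_gt (Real.log e / Real.log x) 1 with hle | hgt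
      · exact le_trans (mul_le_mul hμ (hMG i i.2 _ ⟨hlog0, hle⟩) (abs_nonneg _) zero_le_one) (by rw [one_mul])
      · rw [(hG i i.2).eq_zero _ (lt_of_lt_of_le (hsG1 i i.2) hgt.le), abs_zero, mul_zero]; exact hM0
  have hcc_abs : ∀ d ∈ lcmBox (↥H') D, ∀ d' ∈ lcmBox (↥H') D, |cc d d'| ≤ M ^ k * M ^ k := by
    intro d hd d' hd'
    rw [hccdef]; simp only
    rw [Finset.abs_prod]
    calc ∏ i, |a i (d i) * a' i (d' i)| ≤ ∏ _i : ↥H', (M * M) := by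
          refine Finset.prod_le_prod (fun i _ => abs_nonneg _) fun i _ => ?_
          rw [abs_mul]
          exact mul_le_mul (habs_a i _ (pos_of_mem_lcmBox hd i)).1 (habs_a i _ (pos_of_mem_lcmBox hd' i)).2
            (abs_nonneg _) hM0
      _ = M ^ k * M ^ k := by
          rw [Finset.prod_const, Finset.card_univ, Fintype.card_coe, ← hkdef, mul_pow]
  -- support: `cc ≠ 0` forces squarefree entries with `d_i ≤ x^{sF i}`, `d'_i ≤ x^{sG i}`
  have hsupp_a : ∀ i : ↥H', ∀ e : ℕ, 1 ≤ e → a i e ≠ 0 → Squarefree e ∧ (e : ℝ) ≤ x ^ sF i := by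
    intro i e he hne
    rw [hadef] at hne; simp only at hne
    have hμ : (μ e : ℝ) ≠ 0 := left_ne_zero_of_mul hne
    have hFne : F i (Real.log e / Real.log x) ≠ 0 := right_ne_zero_of_mul hne
    refine ⟨ArithmeticFunction.moebius_ne_zero_iff_squarefree.1 (by exact_mod_cast hμ), ?_⟩
    by_contra hgt
    push Not at hgt
    apply hFne
    apply (hF i i.2).eq_zero
    rw [lt_div_iff₀ hlog, ← Real.log_rpow hxpos]
    exact Real.log_lt_log (Real.rpow_pos_of_pos hxpos _) hgt
  have hsupp_a' : ∀ i : ↥H', ∀ e : ℕ, 1 ≤ e → a' i e ≠ 0 → Squarefree e ∧ (e : ℝ) ≤ x ^ sG i := by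
    intro i e he hne
    rw [ha'def] at hne; simp only at hne
    have hμ : (μ e : ℝ) ≠ 0 := left_ne_zero_of_mul hne
    have hGne : G i (Real.log e / Real.log x) ≠ 0 := right_ne_zero_of_mul hne
    refine ⟨ArithmeticFunction.moebius_ne_zero_iff_squarefree.1 (by exact_mod_cast hμ), ?_⟩
    by_contra hgt
    push Not at hgt
    apply hGne
    apply (hG i i.2).eq_zero
    rw [lt_div_iff₀ hlog, ← Real.log_rpow hxpos]
    exact Real.log_lt_log (Real.rpow_pos_of_pos hxpos _) hgt
  -- the set of pairs carrying the error
  set S : Finset ((↥H' → ℕ) × (↥H' → ℕ)) := (lcmBox (↥H') D ×ˢ lcmBox (↥H') D).filter fun t =>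
    LcmCoprime (polymathW x) t.1 t.2 ∧ (∀ i, Squarefree (t.1 i) ∧ Squarefree (t.2 i)) ∧
      ∀ i, ((t.1 i : ℕ) : ℝ) ≤ x ^ sF i ∧ ((t.2 i : ℕ) : ℝ) ≤ x ^ sG i with hSdef
  have hSprop : ∀ t ∈ S, LcmCoprime (polymathW x) t.1 t.2 ∧ ∀ i, Squarefree (t.1 i) ∧ Squarefree (t.2 i) :=
    fun t ht => ⟨(Finset.mem_filter.1 ht).2.1, (Finset.mem_filter.1 ht).2.2.1⟩
  set Q : ℕ := ⌊((polymathW x : ℕ) : ℝ) * x ^ σ⌋₊ with hQdef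
  have hSQ : ∀ t ∈ S, modulusOf (polymathW x) t ∈ Finset.Icc 1 Q := by
    intro t ht
    obtain ⟨htbox, hadm, hsq, hsize⟩ := Finset.mem_filter.1 ht
    rw [Finset.mem_product] at htbox
    have hpos : ∀ i : ↥H', 0 < t.1 i ∧ 0 < t.2 i :=
      fun i => ⟨pos_of_mem_lcmBox htbox.1 i, pos_of_mem_lcmBox htbox.2 i⟩
    have hqpos : 0 < modulusOf (polymathW x) t :=
      Nat.mul_pos hWpos (Finset.prod_pos fun i _ => Nat.lcm_pos (hpos i).1 (hpos i).2)
    refine Finset.mem_Icc.2 ⟨hqpos, Nat.le_floor ?_⟩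
    rw [modulusOf, Nat.cast_mul, Nat.cast_prod]
    refine mul_le_mul_of_nonneg_left ?_ hWr.le
    have hterm : ∀ i : ↥H', ((Nat.lcm (t.1 i) (t.2 i) : ℕ) : ℝ) ≤ x ^ sF i * x ^ sG i := by
      intro i
      have hlcm : Nat.lcm (t.1 i) (t.2 i) ≤ t.1 i * t.2 i :=
        Nat.le_of_dvd (Nat.mul_pos (hpos i).1 (hpos i).2) (Nat.lcm_dvd_mul _ _)
      calc ((Nat.lcm (t.1 i) (t.2 i) : ℕ) : ℝ) ≤ ((t.1 i * t.2 i : ℕ) : ℝ) := by exact_mod_cast hlcm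
        _ = (t.1 i : ℝ) * (t.2 i : ℝ) := by push_cast; ring
        _ ≤ x ^ sF i * x ^ sG i :=
            mul_le_mul (hsize i).1 (hsize i).2 (Nat.cast_nonneg _) (Real.rpow_nonneg hx0 _)
    calc ∏ i : ↥H', ((Nat.lcm (t.1 i) (t.2 i) : ℕ) : ℝ) ≤ ∏ i : ↥H', (x ^ sF i * x ^ sG i) :=
          Finset.prod_le_prod (fun i _ => Nat.cast_nonneg _) fun i _ => hterm i
      _ = x ^ σ := by
          rw [hσdef, Real.rpow_sum_of_pos hxpos, ← Finset.prod_coe_sort H']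
          exact Finset.prod_congr rfl fun i _ => (Real.rpow_add hxpos _ _).symm
  -- Step 6: the error term
  have herr : |∑ d ∈ lcmBox (↥H') D, ∑ d' ∈ lcmBox (↥H') D, cc d d' * Nθ d d' -
      Θ / Nat.totient (polymathW x) * Sφ x| ≤
      (M ^ k * M ^ k) *
        ∑ q ∈ Finset.Icc 1 Q, K ^ ω q * innerErr (w x) q X₁ X₂ := by
    -- the main part of each admissible term
    have hmain : Θ / Nat.totient (polymathW x) * Sφ x = ∑ d ∈ lcmBox (↥H') D, ∑ d' ∈ lcmBox (↥H') D,
        if LcmCoprime (polymathW x) d d' then cc d d' * (Θ / Nat.totient (modulusOf (polymathW x) (d, d'))) else 0 := by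
      rw [hSφdef]; simp only
      rw [Finset.mul_sum]
      refine Finset.sum_congr rfl fun d _ => ?_
      rw [Finset.mul_sum]
      refine Finset.sum_congr rfl fun d' _ => ?_
      split_ifs with hadm
      · rw [totient_modulusOf (t := (d, d')) hadm, Nat.cast_mul, Nat.cast_prod, hccdef, hadef, ha'def]
        simp only
        rw [Finset.prod_inv_distrib]
        field_simp
      · rw [mul_zero]
    rw [hmain, ← Finset.sum_sub_distrib]
    simp_rw [← Finset.sum_sub_distrib]
    -- termwise bound
    have hterm : ∀ d ∈ lcmBox (↥H') D, ∀ d' ∈ lcmBox (↥H') D,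
        |cc d d' * Nθ d d' - (if LcmCoprime (polymathW x) d d' then cc d d' * (Θ / Nat.totient (modulusOf (polymathW x) (d, d'))) else 0)| ≤
          (M ^ k * M ^ k) * (if (d, d') ∈ S then
            innerErr (w x) (modulusOf (polymathW x) (d, d')) X₁ X₂ else 0) := by
      intro d hd d' hd'
      by_cases hadm : LcmCoprime (polymathW x) d d'
      · rw [if_pos hadm, ← mul_sub, abs_mul]
        by_cases hS : (d, d') ∈ S
        · rw [if_pos hS]
          exact mul_le_mul (hcc_abs d hd d' hd') (hNadm d hd d' hd' hadm) (abs_nonneg _) (by positivity)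
        · -- then `cc d d' = 0`
          have hcc0 : cc d d' = 0 := by
            by_contra hne
            apply hS
            rw [hSdef, Finset.mem_filter, Finset.mem_product]
            have hfac : ∀ i : ↥H', a i (d i) ≠ 0 ∧ a' i (d' i) ≠ 0 := by
              intro i
              rw [hccdef] at hne; simp only at hne
              have := Finset.prod_ne_zero_iff.1 hne i (Finset.mem_univ i)
              exact ⟨left_ne_zero_of_mul this, right_ne_zero_of_mul this⟩
            refine ⟨⟨hd, hd'⟩, hadm, fun i => ?_, fun i => ?_⟩
            · exact ⟨(hsupp_a i _ (pos_of_mem_lcmBox hd i) (hfac i).1).1,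
                (hsupp_a' i _ (pos_of_mem_lcmBox hd' i) (hfac i).2).1⟩
            · exact ⟨(hsupp_a i _ (pos_of_mem_lcmBox hd i) (hfac i).1).2,
                (hsupp_a' i _ (pos_of_mem_lcmBox hd' i) (hfac i).2).2⟩
          rw [hcc0, abs_zero, zero_mul, if_neg hS, mul_zero]
      · rw [if_neg hadm, hNzero d d' hadm, mul_zero, sub_zero, abs_zero]
        refine mul_nonneg (mul_nonneg (pow_nonneg hM0 k) (pow_nonneg hM0 k)) ?_
        split_ifs
        · exact innerErr_nonneg _ _ _ _
        · exact le_rfl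
    calc |∑ d ∈ lcmBox (↥H') D, ∑ d' ∈ lcmBox (↥H') D, (cc d d' * Nθ d d' -
            if LcmCoprime (polymathW x) d d' then cc d d' * (Θ / Nat.totient (modulusOf (polymathW x) (d, d'))) else 0)|
        ≤ ∑ d ∈ lcmBox (↥H') D, ∑ d' ∈ lcmBox (↥H') D, |cc d d' * Nθ d d' -
            (if LcmCoprime (polymathW x) d d' then cc d d' * (Θ / Nat.totient (modulusOf (polymathW x) (d, d'))) else 0)| := by
          refine (Finset.abs_sum_le_sum_abs _ _).trans (Finset.sum_le_sum fun d _ => ?_)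
          exact Finset.abs_sum_le_sum_abs _ _
      _ ≤ ∑ d ∈ lcmBox (↥H') D, ∑ d' ∈ lcmBox (↥H') D, (M ^ k * M ^ k) * (if (d, d') ∈ S then
            innerErr (w x) (modulusOf (polymathW x) (d, d')) X₁ X₂ else 0) :=
          Finset.sum_le_sum fun d hd => Finset.sum_le_sum fun d' hd' => hterm d hd d' hd'
      _ = (M ^ k * M ^ k) * ∑ t ∈ S, innerErr (w x) (modulusOf (polymathW x) t) X₁ X₂ := by
          rw [← Finset.sum_product' (f := fun d d' => (M ^ k * M ^ k) * (if (d, d') ∈ S then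
            innerErr (w x) (modulusOf (polymathW x) (d, d')) X₁ X₂ else 0))]
          simp only [Prod.mk.eta]
          have hSsub : S ⊆ lcmBox (↥H') D ×ˢ lcmBox (↥H') D := Finset.filter_subset _ _
          simp_rw [mul_ite, mul_zero]
          rw [Finset.sum_ite_mem, Finset.inter_eq_right.2 hSsub]
          simp only [Finset.mul_sum]
      _ ≤ (M ^ k * M ^ k) * ∑ q ∈ Finset.Icc 1 Q, K ^ ω q * innerErr (w x) q X₁ X₂ := by
          refine mul_le_mul_of_nonneg_left ?_ (by positivity)
          have := sum_modulusOf_le hWpos S hSprop hSQ (g := fun q => innerErr (w x) q X₁ X₂)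
            (fun q => innerErr_nonneg _ _ _ _)
          rw [Fintype.card_coe, ← hkdef] at this
          rw [hKdef]
          exact this
  -- Step 7: the level of distribution bound (hypothesis (ii)) at this `x`
  have hlevel_bound : (M ^ k * M ^ k) *
      ∑ q ∈ Finset.Icc 1 Q, K ^ ω q * innerErr (w x) q X₁ X₂ ≤ ε / 3 * Mx := by
    -- `Q ≤ x^θ`
    have hlog2 : Real.log x ^ (2 : ℝ) ≤ x ^ ε₁ := by
      have := hxlogε
      rwa [Real.norm_of_nonneg (Real.rpow_nonneg hlog.le _), Real.norm_of_nonneg (Real.rpow_nonneg hx0 _),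
        one_mul] at this
    have hQle : Q ≤ ⌊x ^ θ⌋₊ := by
      refine Nat.floor_le_floor ?_
      calc ((polymathW x : ℕ) : ℝ) * x ^ σ ≤ Real.log x ^ (2 : ℝ) * x ^ σ := by
            refine mul_le_mul_of_nonneg_right ?_ (Real.rpow_nonneg hx0 _)
            rw [Real.rpow_two]; exact hxW
        _ ≤ x ^ ε₁ * x ^ σ := mul_le_mul_of_nonneg_right hlog2 (Real.rpow_nonneg hx0 _)
        _ = x ^ θ := by rw [← Real.rpow_add hxpos]; congr 1; rw [hε₁def]; ring
    have hsum_le : ∑ q ∈ Finset.Icc 1 Q, K ^ ω q * innerErr (w x) q X₁ X₂ ≤ Lsum := by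
      rw [hLsum_def, hX₁def, hX₂def]
      exact Finset.sum_le_sum_of_subset_of_nonneg (Finset.Icc_subset_Icc_right hQle)
        fun q _ _ => mul_nonneg (pow_nonneg hK0 _) (innerErr_nonneg _ _ _ _)
    have hCbx : Lsum ≤ Cb * (x / Real.log x ^ ((k : ℝ) + 4)) := by
      have h := hLsum
      have hnn : 0 ≤ Lsum := by
        rw [hLsum_def]
        exact Finset.sum_nonneg fun q _ => mul_nonneg (pow_nonneg hK0 _) (innerErr_nonneg _ _ _ _)
      rwa [Real.norm_of_nonneg hnn, Real.norm_of_nonneg (div_nonneg hx0 (Real.rpow_nonneg hlog.le _))] at h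
    have hden : polymathB x ^ k * Nat.totient (polymathW x) * Real.log x ≤ Real.log x ^ (k + 3) := by
      have hφW : (Nat.totient (polymathW x) : ℝ) ≤ (polymathW x) := by exact_mod_cast Nat.totient_le (polymathW x)
      calc polymathB x ^ k * Nat.totient (polymathW x) * Real.log x ≤ Real.log x ^ k * Real.log x ^ 2 * Real.log x :=
            mul_le_mul_of_nonneg_right (mul_le_mul (pow_le_pow_left₀ hB.le (polymathB_le_log hx1.le) k)
              (hφW.trans hxW) hφr.le (pow_nonneg hlog.le k)) hlog.le
        _ = Real.log x ^ (k + 3) := by ring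
    have hrpow : Real.log x ^ ((k : ℝ) + 4) = Real.log x ^ (k + 3) * Real.log x := by
      rw [show (k : ℝ) + 4 = ((k + 4 : ℕ) : ℝ) by push_cast; ring, Real.rpow_natCast]; ring
    have hCerr' : Cerr ≤ ε * Real.log x := by
      have h := hxCerr
      rw [div_le_iff₀ hε] at h
      linarith
    have hlk : 0 < Real.log x ^ (k + 3) := pow_pos hlog _
    calc (M ^ k * M ^ k) * ∑ q ∈ Finset.Icc 1 Q, K ^ ω q * innerErr (w x) q X₁ X₂
        ≤ (M ^ k * M ^ k) * (Cb * (x / Real.log x ^ ((k : ℝ) + 4))) :=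
          mul_le_mul_of_nonneg_left (hsum_le.trans hCbx) (by positivity)
      _ = Cerr * x / (3 * (Real.log x ^ (k + 3) * Real.log x)) := by
          rw [hrpow, hCerrdef]; field_simp
      _ ≤ ε * Real.log x * x / (3 * (Real.log x ^ (k + 3) * Real.log x)) := by
          gcongr
      _ = ε / 3 * (x / Real.log x ^ (k + 3)) := by field_simp
      _ ≤ ε / 3 * Mx := by
          rw [hMx]
          refine mul_le_mul_of_nonneg_left (div_le_div_of_nonneg_left hx0 (by positivity) hden) (by positivity)
  -- Step 8: Lemma 4.1 and the prime number theorem at this `x`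
  have h41x : |Sφ x - c * (polymathB x ^ k)⁻¹| ≤ ε41 * (polymathB x ^ k)⁻¹ := by
    have h := hx41
    rw [dist_eq_norm, Real.norm_eq_abs] at h
    have e : Sφ x - c * (polymathB x ^ k)⁻¹ = (polymathB x ^ k)⁻¹ * (polymathB x ^ k * Sφ x - c) := by
      field_simp
    rw [e, abs_mul, abs_of_pos (inv_pos.2 hBk), mul_comm]
    exact mul_le_mul_of_nonneg_right h.le (inv_pos.2 hBk).le
  -- conclusion
  rw [Real.norm_eq_abs, Real.norm_eq_abs, abs_of_pos hMx0, hstep2]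
  have hsplit : ∑ d ∈ lcmBox (↥H') D, ∑ d' ∈ lcmBox (↥H') D, cc d d' * Nθ d d' - cw * c * Mx =
      (∑ d ∈ lcmBox (↥H') D, ∑ d' ∈ lcmBox (↥H') D, cc d d' * Nθ d d' - Θ / Nat.totient (polymathW x) * Sφ x) +
      Θ / Nat.totient (polymathW x) * (Sφ x - c * (polymathB x ^ k)⁻¹) +
      c * (polymathB x ^ k)⁻¹ / Nat.totient (polymathW x) * (Θ - cw * xL) := by
    rw [hMx, hxLdef]; field_simp; ring
  rw [hsplit]
  have hT2 : |Θ / Nat.totient (polymathW x) * (Sφ x - c * (polymathB x ^ k)⁻¹)| ≤ ε / 3 * Mx := by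
    rw [abs_mul, abs_div, abs_of_pos hφr]
    calc |Θ| / Nat.totient (polymathW x) * |Sφ x - c * (polymathB x ^ k)⁻¹|
        ≤ ((|cw| + 1) * xL) / Nat.totient (polymathW x) * (ε41 * (polymathB x ^ k)⁻¹) :=
          mul_le_mul (div_le_div_of_nonneg_right hΘabs hφr.le) h41x (abs_nonneg _) (by positivity)
      _ = (|cw| + 1) * ε41 * Mx := by rw [hMx, hxLdef]; field_simp
      _ = ε / 9 * Mx := by rw [hε41c]
      _ ≤ ε / 3 * Mx := mul_le_mul_of_nonneg_right (by linarith only [hε]) hMx0.le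
  have hT3 : |c * (polymathB x ^ k)⁻¹ / Nat.totient (polymathW x) * (Θ - cw * xL)| ≤ ε / 3 * Mx := by
    rw [abs_mul, abs_div, abs_mul, abs_of_pos (inv_pos.2 hBk), abs_of_pos hφr]
    calc |c| * (polymathB x ^ k)⁻¹ / Nat.totient (polymathW x) * |Θ - cw * xL|
        ≤ |c| * (polymathB x ^ k)⁻¹ / Nat.totient (polymathW x) * (εP * xL) :=
          mul_le_mul_of_nonneg_left hΘx (by positivity)
      _ = |c| * εP * Mx := by rw [hMx, hxLdef]; field_simp
      _ ≤ ε / 3 * Mx := mul_le_mul_of_nonneg_right hεPc hMx0.le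
  calc _ ≤ |∑ d ∈ lcmBox (↥H') D, ∑ d' ∈ lcmBox (↥H') D, cc d d' * Nθ d d' - Θ / Nat.totient (polymathW x) * Sφ x| +
        |Θ / Nat.totient (polymathW x) * (Sφ x - c * (polymathB x ^ k)⁻¹)| +
        |c * (polymathB x ^ k)⁻¹ / Nat.totient (polymathW x) * (Θ - cw * xL)| :=
        (abs_add_le _ _).trans (add_le_add (abs_add_le _ _) le_rfl)
    _ ≤ ε / 3 * Mx + ε / 3 * Mx + ε / 3 * Mx :=
        add_le_add (add_le_add (herr.trans hlevel_bound) hT2) hT3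
    _ = ε * Mx := by ring

end Literature.NumberTheory.Sieve
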